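import Summits.BirchSwinnertonDyer.BirchSwinnertonDyer.Theorems.UniversalToricDescentThinCombDefs
import HarnessLib

/-!
# Thin-comb rigidity (crux idea `thin-comb-reflection` on `AdditiveSplitIMCInclusionAtThree`, item
# stmt-BirchSwinnertonDyer-20395) — Part I: the vertical elements `E_m = Φ_{p^{m+1}}(1+X)` and the level rings
# `𝒪_m = 𝒪⟦X⟧ ⧸ (E_m)` (helper, `--supports stmt-BirchSwinnertonDyer-20395`; cell `pub/bsd-wall`, lead `cruxlead-20395`)

Pure commutative algebra feeding the proof of the rigidity lemma K1 (`…ThinCombRigidity.lean`):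

* §1 `combPoly p m = Φ_{p^{m+1}}(1+X)`: monic, degree `φ(p^{m+1}) > m` (UNBOUNDED in `m`), constant term `p`, all
  non-leading coefficients divisible by `p` (Eisenstein), and the COMB COPRIMALITY `p ∈ (E_m, E_{m'})` for `m ≠ m'`
  (two comb levels meet only above `p`).
* §2 the same for `combSeries 𝒪 p m ∈ 𝒪⟦X⟧`; the shape `E_m = X^d + p·w` with `w` a UNIT of `𝒪⟦X⟧`; `E_m ≡ X^d (mod p)`.
* §3 the level ring `𝒪_m`, `ϖ` = class of `X`, `d = φ(p^{m+1})`: `p = ϖ^d·(unit)`; `X^λ ∉ (E_m)` and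
  `ϖ^λ ∉ (ϖ^{λ+1})` for `λ < d`; `ϖ` and `p` are non-zero-divisors (`𝒪` a domain); the reduction `𝒪_m → 𝒪/(p)`,
  `ϖ ↦ 0`, with kernel `(ϖ)`; `ϖ` is PRIME when `(p)` is prime in `𝒪`.

No Weierstrass preparation, no completeness, no roots of unity are used. Nothing about elliptic curves; BSD is not
proved by any of this. References: Washington, *Introduction to Cyclotomic Fields*, Lemma 1.4 and §7.1–7.2
[cite: Washington1997, Lemma 1.4 and §7.1–§7.2].
-/

set_option linter.dupNamespace false

noncomputable section

namespace Summit.BirchSwinnertonDyer.BirchSwinnertonDyer.Theorems.UniversalToricDescentThinComb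

open Polynomial

/-! ## §1 `E_m = Φ_{p^{m+1}}(1 + X)` over `ℤ` -/

section IntFacts

variable (p m : ℕ) [hp : Fact p.Prime]

omit hp in
/-- `E_m` is monic. [cite: Washington1997, §7.1] -/
theorem combPoly_monic : (combPoly p m).Monic := by
  unfold combPoly
  rw [show (X + 1 : ℤ[X]) = X + Polynomial.C 1 by simp]
  exact (cyclotomic.monic _ ℤ).comp (monic_X_add_C 1) (by rw [natDegree_X_add_C]; exact one_ne_zero)

omit hp in
/-- `deg E_m = φ(p^{m+1})`. [cite: Washington1997, §7.1] -/
theorem natDegree_combPoly : (combPoly p m).natDegree = Nat.totient (p ^ (m + 1)) := by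
  unfold combPoly
  rw [natDegree_comp, natDegree_cyclotomic, show (X + 1 : ℤ[X]) = X + Polynomial.C 1 by simp,
    natDegree_X_add_C, mul_one]

/-- `deg E_m ≥ 1`. [cite: Washington1997, §7.1] -/
theorem natDegree_combPoly_pos : 0 < (combPoly p m).natDegree := by
  rw [natDegree_combPoly]
  exact Nat.totient_pos.mpr (pow_pos hp.out.pos _)

/-- `deg E_m = φ(p^{m+1}) > m`: the levels have UNBOUNDED degree. [cite: Washington1997, §7.1] -/
theorem lt_natDegree_combPoly : m < (combPoly p m).natDegree := by
  rw [natDegree_combPoly, Nat.totient_prime_pow_succ hp.out]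
  have h1 : 1 ≤ p - 1 := Nat.le_sub_one_of_lt hp.out.one_lt
  calc m < p ^ m := Nat.lt_pow_self hp.out.one_lt
    _ = p ^ m * 1 := (mul_one _).symm
    _ ≤ p ^ m * (p - 1) := Nat.mul_le_mul_left _ h1

/-- The constant term of `E_m` is `Φ_{p^{m+1}}(1) = p`. [cite: Washington1997, Lemma 1.4] -/
theorem combPoly_coeff_zero : (combPoly p m).coeff 0 = p := by
  unfold combPoly
  rw [coeff_zero_eq_eval_zero, eval_comp]
  simp [eval_one_cyclotomic_prime_pow]

/-- Eisenstein: every non-leading coefficient of `E_m` is divisible by `p`. [cite: Washington1997, Lemma 1.4] -/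
theorem p_dvd_combPoly_coeff {j : ℕ} (hj : j < (combPoly p m).natDegree) : (p : ℤ) ∣ (combPoly p m).coeff j := by
  have h := (cyclotomic_prime_pow_comp_X_add_one_isEisensteinAt p m).mem hj
  rwa [Ideal.submodule_span_eq, Ideal.mem_span_singleton] at h

/-- COMB COPRIMALITY over `ℤ`: for `m < m'`, `Φ_{p^{m+1}} ∣ Φ_{p^{m'+1}} − p`
(`Φ_{p^{m'+1}}(Y) = Σ_{i<p} Y^{i p^{m'}}` and `Y^{p^{m'}} ≡ 1 (mod Y^{p^{m+1}} − 1)`). [cite: Washington1997, Lemma 1.4] -/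
theorem cyclotomic_dvd_cyclotomic_sub_p {m m' : ℕ} (h : m < m') :
    cyclotomic (p ^ (m + 1)) ℤ ∣ cyclotomic (p ^ (m' + 1)) ℤ - (p : ℤ[X]) := by
  rw [cyclotomic_prime_pow_eq_geom_sum hp.out (n := m')]
  have hsum : (∑ i ∈ Finset.range p, (X ^ p ^ m') ^ i : ℤ[X]) - (p : ℤ[X]) =
      ∑ i ∈ Finset.range p, ((X ^ p ^ m') ^ i - 1) := by
    rw [Finset.sum_sub_distrib]
    simp
  rw [hsum]
  refine Finset.dvd_sum fun i _ => ?_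
  have h1 : cyclotomic (p ^ (m + 1)) ℤ ∣ X ^ p ^ (m + 1) - 1 := cyclotomic.dvd_X_pow_sub_one _ ℤ
  have h2 : (X : ℤ[X]) ^ p ^ (m + 1) - 1 ∣ (X ^ p ^ m') ^ i - 1 := by
    rw [← pow_mul]
    exact dvd_pow_sub_one_of_dvd (dvd_mul_of_dvd_left (pow_dvd_pow p (Nat.succ_le_of_lt h)) i)
  exact h1.trans h2

/-- COMB COPRIMALITY: `p ∈ (E_m, E_{m'})` in `ℤ[X]` for `m ≠ m'` — two distinct comb levels have no common zero away
from `p`. [cite: Washington1997, Lemma 1.4] -/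
theorem p_mem_span_combPoly {m m' : ℕ} (h : m ≠ m') :
    (p : ℤ[X]) ∈ Ideal.span {combPoly p m, combPoly p m'} := by
  -- the statement for cyclotomic polynomials, then transport along `f ↦ f.comp (X + 1)`
  have key : ∀ {a b : ℕ}, a < b →
      (p : ℤ[X]) ∈ Ideal.span {cyclotomic (p ^ (a + 1)) ℤ, cyclotomic (p ^ (b + 1)) ℤ} := by
    intro a b hab
    obtain ⟨q, hq⟩ := cyclotomic_dvd_cyclotomic_sub_p p hab
    rw [Ideal.mem_span_pair]
    exact ⟨-q, 1, by linear_combination hq⟩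
  have key' : (p : ℤ[X]) ∈ Ideal.span {cyclotomic (p ^ (m + 1)) ℤ, cyclotomic (p ^ (m' + 1)) ℤ} := by
    rcases Nat.lt_or_gt_of_ne h with hlt | hgt
    · exact key hlt
    · rw [Ideal.span_pair_comm]; exact key hgt
  obtain ⟨a, b, hab⟩ := Ideal.mem_span_pair.mp key'
  rw [Ideal.mem_span_pair]
  refine ⟨a.comp (X + 1), b.comp (X + 1), ?_⟩
  have := congrArg (fun f : ℤ[X] => f.comp (X + 1)) hab
  simpa only [add_comp, mul_comp, natCast_comp, combPoly] using this

end IntFacts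

/-! ## §2 `E_m ∈ 𝒪⟦X⟧` -/

section SeriesFacts

variable (𝒪 : Type*) [CommRing 𝒪] (p m : ℕ) [hp : Fact p.Prime]

omit hp in
/-- Coefficients of `combSeries` are the cast coefficients of `combPoly`. [cite: Washington1997, §7.1] -/
theorem coeff_combSeries (j : ℕ) :
    PowerSeries.coeff j (combSeries 𝒪 p m) = ((combPoly p m).coeff j : 𝒪) := by
  simp [combSeries, Polynomial.coeff_coe]

/-- `E_m(0) = p` in `𝒪`. [cite: Washington1997, Lemma 1.4] -/
theorem constantCoeff_combSeries : PowerSeries.constantCoeff (combSeries 𝒪 p m) = (p : 𝒪) := by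
  rw [← PowerSeries.coeff_zero_eq_constantCoeff_apply, coeff_combSeries, combPoly_coeff_zero]
  simp

omit hp in
/-- The leading coefficient: `[X^d] E_m = 1`, `d = deg E_m`. [cite: Washington1997, §7.1] -/
theorem coeff_combSeries_natDegree :
    PowerSeries.coeff (combPoly p m).natDegree (combSeries 𝒪 p m) = 1 := by
  rw [coeff_combSeries]
  have := (combPoly_monic p m).coeff_natDegree
  rw [this]; simp

omit hp in
/-- Above the degree the coefficients vanish. [cite: Washington1997, §7.1] -/
theorem coeff_combSeries_eq_zero {j : ℕ} (hj : (combPoly p m).natDegree < j) :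
    PowerSeries.coeff j (combSeries 𝒪 p m) = 0 := by
  rw [coeff_combSeries, coeff_eq_zero_of_natDegree_lt hj]; simp

/-- Below the degree the coefficients are divisible by `p`. [cite: Washington1997, Lemma 1.4] -/
theorem p_dvd_coeff_combSeries {j : ℕ} (hj : j < (combPoly p m).natDegree) :
    (p : 𝒪) ∣ PowerSeries.coeff j (combSeries 𝒪 p m) := by
  rw [coeff_combSeries]
  obtain ⟨c, hc⟩ := p_dvd_combPoly_coeff p m hj
  exact ⟨(c : 𝒪), by rw [hc]; push_cast; ring⟩

/-- **Shape of `E_m`**: `E_m = X^d + p·w` with `w ∈ 𝒪⟦X⟧` a UNIT (`w(0) = 1`), `d = deg E_m`.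
[cite: Washington1997, Lemma 1.4 and §7.1] -/
theorem combSeries_eq_X_pow_add :
    ∃ w : PowerSeries 𝒪, PowerSeries.constantCoeff w = 1 ∧
      combSeries 𝒪 p m = PowerSeries.X ^ (combPoly p m).natDegree + PowerSeries.C (p : 𝒪) * w := by
  classical
  set d := (combPoly p m).natDegree with hd
  -- exact quotients `c_j / p` of the lower coefficients
  refine ⟨PowerSeries.mk fun j => if j < d then (((combPoly p m).coeff j / (p : ℤ) : ℤ) : 𝒪) else 0, ?_, ?_⟩
  · rw [← PowerSeries.coeff_zero_eq_constantCoeff_apply, PowerSeries.coeff_mk, if_pos (natDegree_combPoly_pos p m),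
      combPoly_coeff_zero, Int.ediv_self (by exact_mod_cast hp.out.ne_zero)]
    simp
  · ext j
    rw [map_add, PowerSeries.coeff_C_mul, PowerSeries.coeff_mk, PowerSeries.coeff_X_pow]
    rcases lt_trichotomy j d with hlt | heq | hgt
    · rw [if_neg hlt.ne, if_pos hlt, zero_add, coeff_combSeries]
      obtain ⟨c, hc⟩ := p_dvd_combPoly_coeff p m hlt
      rw [hc, Int.mul_ediv_cancel_left _ (by exact_mod_cast hp.out.ne_zero)]
      push_cast; ring
    · rw [heq, if_pos rfl, if_neg (lt_irrefl _), mul_zero, add_zero, coeff_combSeries_natDegree]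
    · rw [if_neg hgt.ne', if_neg (lt_asymm hgt), mul_zero, add_zero, coeff_combSeries_eq_zero 𝒪 p m hgt]

/-- `E_m ≡ X^d (mod p)`. [cite: Washington1997, §7.1] -/
theorem map_combSeries_eq_X_pow :
    PowerSeries.map (Ideal.Quotient.mk (Ideal.span {(p : 𝒪)})) (combSeries 𝒪 p m) =
      PowerSeries.X ^ (combPoly p m).natDegree := by
  obtain ⟨w, -, hw⟩ := combSeries_eq_X_pow_add 𝒪 p m
  rw [hw, map_add, map_pow, PowerSeries.map_X, map_mul, PowerSeries.map_C,
    Ideal.Quotient.eq_zero_iff_mem.mpr (Ideal.mem_span_singleton_self _)]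
  simp

/-- COMB COPRIMALITY in `𝒪⟦X⟧`: `p ∈ (E_m, E_{m'})` for `m ≠ m'`. [cite: Washington1997, Lemma 1.4] -/
theorem p_mem_span_combSeries {m m' : ℕ} (h : m ≠ m') :
    (PowerSeries.C (p : 𝒪)) ∈ Ideal.span {combSeries 𝒪 p m, combSeries 𝒪 p m'} := by
  obtain ⟨a, b, hab⟩ := Ideal.mem_span_pair.mp (p_mem_span_combPoly p h)
  let ψ : ℤ[X] →+* PowerSeries 𝒪 :=
    (Polynomial.coeToPowerSeries.ringHom (R := 𝒪)).comp (Polynomial.mapRingHom (Int.castRingHom 𝒪))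
  have hψ : ∀ k, ψ (combPoly p k) = combSeries 𝒪 p k := fun k => rfl
  have := congrArg ψ hab
  rw [map_add, map_mul, map_mul, hψ, hψ, map_natCast] at this
  rw [Ideal.mem_span_pair]
  exact ⟨ψ a, ψ b, by rw [this]; simp⟩

/-- `E_m` is not a unit of `𝒪⟦X⟧` when `p` is not a unit of `𝒪`. [cite: Washington1997, §7.1] -/
theorem combSeries_not_isUnit (hpu : ¬ IsUnit (p : 𝒪)) : ¬ IsUnit (combSeries 𝒪 p m) := by
  intro h
  apply hpu
  have := PowerSeries.isUnit_constantCoeff _ h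
  rwa [constantCoeff_combSeries] at this

end SeriesFacts

/-! ## §3 The level ring `𝒪_m = 𝒪⟦X⟧ ⧸ (E_m)` -/

section Level

variable (𝒪 : Type*) [CommRing 𝒪] (p m : ℕ) [hp : Fact p.Prime]

/-- `p = ϖ^d · (unit)` in `𝒪_m`, where `ϖ` is the class of `X` and `d = deg E_m`. [cite: Washington1997, Lemma 1.4] -/
theorem exists_natCast_p_eq_varpi_pow_mul :
    ∃ u : (LevelRing 𝒪 p m)ˣ, (p : LevelRing 𝒪 p m) =
      (Ideal.Quotient.mk (Ideal.span {combSeries 𝒪 p m}) PowerSeries.X) ^ (combPoly p m).natDegree * u := by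
  obtain ⟨w, hw1, hw⟩ := combSeries_eq_X_pow_add 𝒪 p m
  have hwu : IsUnit w := PowerSeries.isUnit_iff_constantCoeff.mpr (by rw [hw1]; exact isUnit_one)
  set π := Ideal.Quotient.mk (Ideal.span {combSeries 𝒪 p m}) with hπ
  have hwu' : IsUnit (π w) := hwu.map π
  obtain ⟨u, hu⟩ := hwu'
  have h0 : π (combSeries 𝒪 p m) = 0 := Ideal.Quotient.eq_zero_iff_mem.mpr (Ideal.mem_span_singleton_self _)
  have h0' : π PowerSeries.X ^ (combPoly p m).natDegree + π (PowerSeries.C (p : 𝒪)) * ↑u = 0 := by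
    rw [hu, ← map_pow, ← map_mul, ← map_add, ← hw, h0]
  refine ⟨-u⁻¹, ?_⟩
  have hp' : (p : LevelRing 𝒪 p m) = π (PowerSeries.C (p : 𝒪)) := by simp [hπ]
  rw [hp']
  have h1 : π (PowerSeries.C (p : 𝒪)) * ↑u = -(π PowerSeries.X ^ (combPoly p m).natDegree) :=
    eq_neg_of_add_eq_zero_right h0'
  have : π (PowerSeries.C (p : 𝒪)) = -(π PowerSeries.X ^ (combPoly p m).natDegree) * ↑u⁻¹ := by
    rw [← h1, Units.mul_inv_cancel_right]
  rw [this, Units.val_neg]; ring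


/-- `p ∈ (ϖ^d)` in `𝒪_m`. [cite: Washington1997, Lemma 1.4] -/
theorem natCast_p_mem_span_varpi_pow :
    (p : LevelRing 𝒪 p m) ∈
      Ideal.span {(Ideal.Quotient.mk (Ideal.span {combSeries 𝒪 p m}) PowerSeries.X) ^ (combPoly p m).natDegree} := by
  obtain ⟨u, hu⟩ := exists_natCast_p_eq_varpi_pow_mul 𝒪 p m
  rw [hu]
  exact Ideal.mul_mem_right _ _ (Ideal.mem_span_singleton_self _)

/-- `X^λ ∉ (E_m)` in `𝒪⟦X⟧` for `λ < d` (reduce mod `p`: `E_m ≡ X^d`), provided `p` is not a unit of `𝒪`.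
[cite: Washington1997, §7.1] -/
theorem X_pow_not_mem_span_combSeries (hpu : ¬ IsUnit (p : 𝒪)) {l : ℕ} (hl : l < (combPoly p m).natDegree) :
    PowerSeries.X ^ l ∉ Ideal.span {combSeries 𝒪 p m} := by
  intro h
  obtain ⟨c, hc⟩ := Ideal.mem_span_singleton'.mp h
  -- reduce modulo `p`
  have hne : Ideal.span {(p : 𝒪)} ≠ ⊤ := by
    rwa [Ne, Ideal.span_singleton_eq_top]
  haveI : Nontrivial (𝒪 ⧸ Ideal.span {(p : 𝒪)}) := Ideal.Quotient.nontrivial_iff.mpr hne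
  have := congrArg (PowerSeries.map (Ideal.Quotient.mk (Ideal.span {(p : 𝒪)}))) hc
  rw [map_mul, map_combSeries_eq_X_pow, map_pow, PowerSeries.map_X] at this
  have := congrArg (PowerSeries.coeff l) this
  rw [PowerSeries.coeff_X_pow_self, mul_comm, PowerSeries.coeff_X_pow_mul', if_neg (not_le.mpr hl)] at this
  exact zero_ne_one this

/-- `ϖ^λ ∉ (ϖ^{λ+1})` in `𝒪_m` for `λ < d`. [cite: Washington1997, §7.1] -/
theorem varpi_pow_not_mem_span_succ (hpu : ¬ IsUnit (p : 𝒪)) {l : ℕ} (hl : l < (combPoly p m).natDegree) :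
    (Ideal.Quotient.mk (Ideal.span {combSeries 𝒪 p m}) PowerSeries.X) ^ l ∉
      Ideal.span {(Ideal.Quotient.mk (Ideal.span {combSeries 𝒪 p m}) PowerSeries.X) ^ (l + 1)} := by
  intro h
  obtain ⟨z, hz⟩ := Ideal.mem_span_singleton'.mp h
  obtain ⟨z, rfl⟩ := Ideal.Quotient.mk_surjective z
  rw [← map_pow, ← map_pow, ← map_mul, Ideal.Quotient.eq, Ideal.mem_span_singleton'] at hz
  obtain ⟨c, hc⟩ := hz
  -- `X^l · (z X - 1) = c · E_m`, and `z X - 1` is a unit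
  have hunit : IsUnit (z * PowerSeries.X - 1 : PowerSeries 𝒪) := by
    rw [PowerSeries.isUnit_iff_constantCoeff]
    simp
  apply X_pow_not_mem_span_combSeries 𝒪 p m hpu hl
  rw [Ideal.mem_span_singleton']
  refine ⟨c * ↑hunit.unit⁻¹, ?_⟩
  have hc' : c * combSeries 𝒪 p m = PowerSeries.X ^ l * (z * PowerSeries.X - 1) := by
    rw [hc]; ring
  rw [mul_right_comm, hc', mul_assoc, IsUnit.mul_val_inv, mul_one]

/-- The reduction `𝒪_m → 𝒪/(p)`, `ϖ ↦ 0` (i.e. `f ↦ f(0) mod p`). [cite: Washington1997, §7.1] -/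
theorem exists_levelRing_to_residue :
    ∃ σ : LevelRing 𝒪 p m →+* 𝒪 ⧸ Ideal.span {(p : 𝒪)},
      Function.Surjective σ ∧
      σ.comp (Ideal.Quotient.mk _) = (Ideal.Quotient.mk (Ideal.span {(p : 𝒪)})).comp PowerSeries.constantCoeff ∧
      RingHom.ker σ = Ideal.span {Ideal.Quotient.mk (Ideal.span {combSeries 𝒪 p m}) PowerSeries.X} := by
  set π₀ : PowerSeries 𝒪 →+* 𝒪 ⧸ Ideal.span {(p : 𝒪)} :=
    (Ideal.Quotient.mk (Ideal.span {(p : 𝒪)})).comp PowerSeries.constantCoeff with hπ₀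
  have hker : ∀ a ∈ Ideal.span {combSeries 𝒪 p m}, π₀ a = 0 := by
    intro a ha
    obtain ⟨c, rfl⟩ := Ideal.mem_span_singleton'.mp ha
    rw [hπ₀, RingHom.comp_apply, map_mul, constantCoeff_combSeries, map_mul,
      Ideal.Quotient.eq_zero_iff_mem.mpr (Ideal.mem_span_singleton_self (p : 𝒪)), mul_zero]
  refine ⟨Ideal.Quotient.lift _ π₀ hker, ?_, ?_, ?_⟩
  · intro x
    obtain ⟨a, rfl⟩ := Ideal.Quotient.mk_surjective x
    exact ⟨Ideal.Quotient.mk _ (PowerSeries.C a), by simp [hπ₀]⟩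
  · exact RingHom.ext fun a => by simp [hπ₀]
  · apply le_antisymm
    · intro x hx
      obtain ⟨f, rfl⟩ := Ideal.Quotient.mk_surjective x
      rw [RingHom.mem_ker, Ideal.Quotient.lift_mk] at hx
      simp only [hπ₀, RingHom.coe_comp, Function.comp_apply, Ideal.Quotient.eq_zero_iff_mem,
        Ideal.mem_span_singleton] at hx
      obtain ⟨a, ha⟩ := hx
      -- `f = X·f' + C (f 0)` and `f 0 = p a`
      rw [PowerSeries.eq_X_mul_shift_add_const f, ha, map_add, map_mul]
      refine Ideal.add_mem _ (Ideal.mul_mem_right _ _ (Ideal.mem_span_singleton_self _)) ?_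
      simp only [map_mul, map_natCast]
      refine Ideal.mul_mem_right _ _ ?_
      have hle : Ideal.span {(Ideal.Quotient.mk (Ideal.span {combSeries 𝒪 p m}) PowerSeries.X) ^
          (combPoly p m).natDegree} ≤
          Ideal.span {Ideal.Quotient.mk (Ideal.span {combSeries 𝒪 p m}) PowerSeries.X} :=
        Ideal.span_singleton_le_span_singleton.mpr (dvd_pow_self _ (natDegree_combPoly_pos p m).ne')
      exact hle (natCast_p_mem_span_varpi_pow 𝒪 p m)
    · rw [Ideal.span_le, Set.singleton_subset_iff, SetLike.mem_coe, RingHom.mem_ker, Ideal.Quotient.lift_mk]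
      simp [hπ₀]

variable [IsDomain 𝒪]

/-- `ϖ` is a non-zero-divisor of `𝒪_m` (`𝒪` a domain, `p ≠ 0` in `𝒪`). [cite: Washington1997, §7.1] -/
theorem varpi_mul_eq_zero_imp (hp0 : (p : 𝒪) ≠ 0) {z : LevelRing 𝒪 p m}
    (hz : Ideal.Quotient.mk (Ideal.span {combSeries 𝒪 p m}) PowerSeries.X * z = 0) : z = 0 := by
  obtain ⟨z, rfl⟩ := Ideal.Quotient.mk_surjective z
  rw [← map_mul, Ideal.Quotient.eq_zero_iff_mem, Ideal.mem_span_singleton'] at hz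
  obtain ⟨c, hc⟩ := hz
  -- constant coefficients: `c(0) · p = 0`, so `X ∣ c`
  have h0 : PowerSeries.constantCoeff c = 0 := by
    have := congrArg PowerSeries.constantCoeff hc
    rw [map_mul, constantCoeff_combSeries, map_mul, PowerSeries.constantCoeff_X, zero_mul] at this
    exact (mul_eq_zero.mp this).resolve_right hp0
  obtain ⟨c', rfl⟩ := PowerSeries.X_dvd_iff.mpr h0
  rw [Ideal.Quotient.eq_zero_iff_mem, Ideal.mem_span_singleton']
  refine ⟨c', ?_⟩
  have : PowerSeries.X * (c' * combSeries 𝒪 p m) = PowerSeries.X * z := by rw [← hc]; ring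
  exact mul_left_cancel₀ PowerSeries.X_ne_zero this

/-- `p` is a non-zero-divisor of `𝒪_m`. [cite: Washington1997, §7.1] -/
theorem natCast_p_mul_eq_zero_imp (hp0 : (p : 𝒪) ≠ 0) {z : LevelRing 𝒪 p m} (hz : (p : LevelRing 𝒪 p m) * z = 0) :
    z = 0 := by
  obtain ⟨u, hu⟩ := exists_natCast_p_eq_varpi_pow_mul 𝒪 p m
  rw [hu, mul_assoc] at hz
  have key : ∀ (n : ℕ) (y : LevelRing 𝒪 p m),
      (Ideal.Quotient.mk (Ideal.span {combSeries 𝒪 p m}) PowerSeries.X) ^ n * y = 0 → y = 0 := by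
    intro n
    induction n with
    | zero => intro y hy; simpa using hy
    | succ n ih =>
      intro y hy
      rw [pow_succ, mul_assoc] at hy
      exact varpi_mul_eq_zero_imp 𝒪 p m hp0 (ih _ hy)
  have := key _ _ hz
  simpa using this

/-- `ϖ` is a PRIME element of `𝒪_m` when `(p)` is a prime ideal of the domain `𝒪` (`𝒪_m/(ϖ) = 𝒪/(p)`).
[cite: Washington1997, §7.1] -/
theorem varpi_prime [(Ideal.span {(p : 𝒪)}).IsPrime] (hp0 : (p : 𝒪) ≠ 0) :
    Prime (Ideal.Quotient.mk (Ideal.span {combSeries 𝒪 p m}) PowerSeries.X) := by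
  obtain ⟨σ, -, -, hker⟩ := exists_levelRing_to_residue 𝒪 p m
  have hpu : ¬ IsUnit (p : 𝒪) := fun hu =>
    Ideal.IsPrime.ne_top' (Ideal.span_singleton_eq_top.mpr hu)
  haveI : Nontrivial (LevelRing 𝒪 p m) :=
    Ideal.Quotient.nontrivial_iff.mpr (Ideal.span_singleton_ne_top (combSeries_not_isUnit 𝒪 p m hpu))
  have hne : Ideal.Quotient.mk (Ideal.span {combSeries 𝒪 p m}) PowerSeries.X ≠ 0 := by
    intro h
    have h1 : (1 : LevelRing 𝒪 p m) = 0 :=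
      varpi_mul_eq_zero_imp 𝒪 p m hp0 (z := 1) (by rw [h, zero_mul])
    exact one_ne_zero h1
  rw [← Ideal.span_singleton_prime hne, ← hker]
  exact RingHom.ker_isPrime σ

end Level

end Summit.BirchSwinnertonDyer.BirchSwinnertonDyer.Theorems.UniversalToricDescentThinComb

end
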